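import Mathlib
import HarnessLib
import Summits.HubbardSuperconductivity.HubbardSuperconductivity.Theorems.KLProgrammeKLRegimeSplitThermalLayer
import Summits.HubbardSuperconductivity.HubbardSuperconductivity.Theorems.KLProgrammeMatsubaraRiemannSum
import Summits.HubbardSuperconductivity.HubbardSuperconductivity.Theorems.KLProgrammeKLRegimeSplitLegStaging

/-!
# Route `KLProgramme` — crux K3 split, ENGINE child `KLRegimeEngineV7` (stmt-HubbardSuperconductivity-19662): the Matsubara error
# IN SCALE FORM lands under `thermalBar`, and the (D) sums of the `Q`-staged leg majorant `legDressBarQ` of the V7 engine slot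
# `EngineBoundsAtV5S` over the extended ladder (cell gate-hubbard-kl, seat hubbard-kl-k3c2-p2 «thermal-bar induction n ≤ nScales β + 1»)

Joins `…MatsubaraRiemannSum` (p454164: `‖β⁻¹•Σ_ω g(ω) − (2π)⁻¹•∫ g‖ ≤ D·(R + 2π/β)/β`, `M`-uniform) to `…SplitThermalLayer` (p454158:
`(π/β)/Λ_n ≤ 4^{-(n_β − n)}`, `C·(Klam U)²·(π/β)/Λ_n ≤ thermalBar`):
* §1 SCALE FORM.  If the `k₀`-integrand at scale `n` is supported in `|k₀| ≤ a·Λ_n` and `D`-Lipschitz with `D ≤ A/Λ_n²` (the natural sizes of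
  a single-slice bubble integrand: magnitude `≍ 1/Λ_n` over a `k₀`-range `≍ Λ_n`), then for `β ≥ klBetaMin`, `n ≤ n_β` and every Matsubara
  cutoff `M ≥ β·aΛ_n/(2π) + 1` the discretisation error is `≤ ((a+2)·A/π)·(π/β)/Λ_n ≤ ((a+2)·A/π)·4^{-(n_β−n)}`
  (`klti_matsubara_error_le_ratio`, `klti_matsubara_error_le_inv_pow`), hence `≤ thermalBar G P U β n` as soon as
  `(a+2)·A/π ≤ C·(Klam U)²` with `0 ≤ C ≤ G.CF` (`klti_matsubara_error_le_thermalBar`) — the (T) clause's majorant, reached from a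
  Riemann-sum estimate with no further arithmetic.
* §2 (D), `Q`-STAGED (Δ15, p1's `…SplitLegStaging` p450191: `legDressBarQ G P Q U n c = Q.CR·((Klam U)²·4^{-n} + (Klam|U|)³)·c`, the
  majorant of `EngineBoundsAtV5S`'s three value clauses): per scale `≤ 4·Q.CR·((Klam U)²·4^{-n} + (Klam|U|)³)` (at most four legs) and,
  summed along ANY stretch of the ladder (in particular `n ≤ n_β + 1`), `Σ_n legDressBarQ … n (legSliceCount … n k) ≤
  Q.CR·((16/3)·(Klam U)² + 20·(Klam|U|)³)` (`Σ_n 4^{-n}·legSliceCount ≤ 4·Σ 4^{-n} ≤ 16/3`, `Σ_n legSliceCount ≤ 20` — p1's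
  `legSliceCount_sum_le`): the constants a consumer of the V7 tower pays for the leg dressing (`klti_legDressBarQ_sum_le`, `…_Ioc_…`).
Pure real arithmetic; nothing about the model is asserted.
-/

noncomputable section

namespace Summit.HubbardSuperconductivity.HubbardSuperconductivity.Theorems.KLRegimeSplit

set_option linter.dupNamespace false -- summit = problem name (single-conjunct summit), D-0017

open Real Finset MeasureTheory Literature.MathematicalPhysics.QuantumLattice Literature.Probability.LatticeModels
open Summit.HubbardSuperconductivity.HubbardSuperconductivity.Theorems.KLProgrammeLegKernels

/-! ## §1 The Matsubara error in scale form -/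

section ScaleForm

variable {E : Type*} [NormedAddCommGroup E] [NormedSpace ℝ E] [CompleteSpace E]

/-- In the multiscale regime the Matsubara mesh is below twice any scale of the ladder: `2π/β ≤ 2Λ_n` for `n ≤ n_β`, `β ≥ klBetaMin`. -/
theorem klti_two_pi_div_le_two_mul_klScale {β : ℝ} (hβ : klBetaMin ≤ β) {n : ℕ} (hn : n ≤ nScales β) :
    2 * Real.pi / β ≤ 2 * klScale klE0 n := by
  have h1 := klth_pi_div_le_klScale_nScales hβ
  have h2 : klScale klE0 (nScales β) ≤ klScale klE0 n := by
    unfold klScale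
    have he : (0 : ℝ) < klE0 := by norm_num [klE0]
    exact mul_le_mul_of_nonneg_left (inv_anti₀ (by positivity) (pow_le_pow_right₀ (by norm_num) hn)) he.le
  rw [mul_div_assoc]
  linarith

/-- **The Matsubara error in the «temperature / scale» form.**  `g : ℝ → E` supported in `|k₀| ≤ a·Λ_n` (`a ≥ 0`) and `D`-Lipschitz with
`D ≤ A/Λ_n²`; `β ≥ klBetaMin`, `n ≤ n_β`, `M ≥ β·aΛ_n/(2π) + 1`.  Then
`‖β⁻¹ • Σ_{i : MatsubaraIdx M} g(ω_i) − (2π)⁻¹ • ∫ g‖ ≤ ((a+2)·A/π)·((π/β)/Λ_n)`. -/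
theorem klti_matsubara_error_le_ratio {g : ℝ → E} {D A a : ℝ} (hD : 0 ≤ D) (ha : 0 ≤ a)
    (hlip : ∀ t t', ‖g t - g t'‖ ≤ D * |t - t'|) {n : ℕ} (hsupp : ∀ t, a * klScale klE0 n ≤ |t| → g t = 0)
    (hDA : D ≤ A / klScale klE0 n ^ 2) {β : ℝ} (hβ : klBetaMin ≤ β) (hn : n ≤ nScales β) {M : ℕ}
    (hM : β * (a * klScale klE0 n) / (2 * Real.pi) + 1 ≤ M) :
    ‖β⁻¹ • (∑ i : MatsubaraIdx M, g (matsubaraFreq β M i)) - (2 * Real.pi)⁻¹ • ∫ t, g t‖ ≤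
      ((a + 2) * A / Real.pi) * ((Real.pi / β) / klScale klE0 n) := by
  have hβ0 : 0 < β := pos_of_klBetaMin_le hβ
  have hΛ : 0 < klScale klE0 n := klth_klScale_pos n
  have hR : 0 ≤ a * klScale klE0 n := mul_nonneg ha hΛ.le
  have h1 := klmr_matsubara_sum_sub_integral_norm_le hD hlip hR hsupp hβ0 hM
  refine h1.trans ?_
  -- `R + 2π/β ≤ (a + 2) Λ_n`
  have h2 : a * klScale klE0 n + 2 * Real.pi / β ≤ (a + 2) * klScale klE0 n := by
    have := klti_two_pi_div_le_two_mul_klScale hβ hn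
    linarith
  have hA : 0 ≤ A := by
    have : 0 ≤ A / klScale klE0 n ^ 2 := hD.trans hDA
    rwa [le_div_iff₀ (by positivity), zero_mul] at this
  calc D * (a * klScale klE0 n + 2 * Real.pi / β) / β
      ≤ (A / klScale klE0 n ^ 2) * ((a + 2) * klScale klE0 n) / β :=
        div_le_div_of_nonneg_right (mul_le_mul hDA h2 (by positivity) (hD.trans hDA)) hβ0.le
    _ = ((a + 2) * A / Real.pi) * ((Real.pi / β) / klScale klE0 n) := by
        field_simp

/-- **The Matsubara error under the thermal profile**: same hypotheses; the error is `≤ ((a+2)·A/π)·4^{-(n_β − n)}`. -/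
theorem klti_matsubara_error_le_inv_pow {g : ℝ → E} {D A a : ℝ} (hD : 0 ≤ D) (ha : 0 ≤ a)
    (hlip : ∀ t t', ‖g t - g t'‖ ≤ D * |t - t'|) {n : ℕ} (hsupp : ∀ t, a * klScale klE0 n ≤ |t| → g t = 0)
    (hDA : D ≤ A / klScale klE0 n ^ 2) {β : ℝ} (hβ : klBetaMin ≤ β) (hn : n ≤ nScales β) {M : ℕ}
    (hM : β * (a * klScale klE0 n) / (2 * Real.pi) + 1 ≤ M) :
    ‖β⁻¹ • (∑ i : MatsubaraIdx M, g (matsubaraFreq β M i)) - (2 * Real.pi)⁻¹ • ∫ t, g t‖ ≤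
      ((a + 2) * A / Real.pi) * ((4 : ℝ) ^ (nScales β - n))⁻¹ := by
  refine (klti_matsubara_error_le_ratio hD ha hlip hsupp hDA hβ hn hM).trans ?_
  have hA : 0 ≤ A := by
    have : 0 ≤ A / klScale klE0 n ^ 2 := hD.trans hDA
    rwa [le_div_iff₀ (pow_pos (klth_klScale_pos n) 2), zero_mul] at this
  exact mul_le_mul_of_nonneg_left (klth_ratio_le_inv_pow hβ hn) (by positivity)

/-- **The Matsubara error lands under the slot's (T) majorant**: same hypotheses, and the size is a second-order unit below the freezing
constant, `(a+2)·A/π ≤ C·(Klam U)²` with `0 ≤ C ≤ G.CF`.  Then the error is `≤ thermalBar G P U β n`. -/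
theorem klti_matsubara_error_le_thermalBar {g : ℝ → E} {D A a : ℝ} (hD : 0 ≤ D) (ha : 0 ≤ a)
    (hlip : ∀ t t', ‖g t - g t'‖ ≤ D * |t - t'|) {n : ℕ} (hsupp : ∀ t, a * klScale klE0 n ≤ |t| → g t = 0)
    (hDA : D ≤ A / klScale klE0 n ^ 2) {β : ℝ} (hβ : klBetaMin ≤ β) (hn : n ≤ nScales β) {M : ℕ}
    (hM : β * (a * klScale klE0 n) / (2 * Real.pi) + 1 ≤ M) {G : GeoConsts} (P : SplitConsts) (U : ℝ) {C : ℝ} (hC : 0 ≤ C)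
    (hCF : C ≤ G.CF) (hsize : (a + 2) * A / Real.pi ≤ C * (P.Klam * U) ^ 2) :
    ‖β⁻¹ • (∑ i : MatsubaraIdx M, g (matsubaraFreq β M i)) - (2 * Real.pi)⁻¹ • ∫ t, g t‖ ≤ thermalBar G P U β n := by
  refine (klti_matsubara_error_le_ratio hD ha hlip hsupp hDA hβ hn hM).trans ?_
  refine le_trans ?_ (klth_ratio_mul_le_thermalBar hC hCF P U hβ hn)
  have hr : 0 ≤ (Real.pi / β) / klScale klE0 n :=
    div_nonneg (div_nonneg Real.pi_pos.le (pos_of_klBetaMin_le hβ).le) (klth_klScale_pos n).le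
  exact mul_le_mul_of_nonneg_right hsize hr

end ScaleForm

/-! ## §2 The (D) sums of the `Q`-staged leg majorant over the extended ladder -/

section LegQ

variable (L : ℕ) [NeZero L]

/-- `Σ_{n ≤ N} 4^{-n} ≤ 4/3`. -/
theorem klti_sum_inv_four_pow_le (N : ℕ) : ∑ n ∈ range (N + 1), ((4 : ℝ) ^ n)⁻¹ ≤ 4 / 3 := by
  have h := geom_sum_Ico_le_of_lt_one (m := 0) (n := N + 1) (x := (4 : ℝ)⁻¹) (by norm_num) (by norm_num)
  rw [← range_eq_Ico] at h
  calc ∑ n ∈ range (N + 1), ((4 : ℝ) ^ n)⁻¹ = ∑ n ∈ range (N + 1), ((4 : ℝ)⁻¹) ^ n :=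
        sum_congr rfl fun n _ => by rw [inv_pow]
    _ ≤ 4 / 3 := h.trans (by norm_num)

omit [NeZero L] in
/-- **(D)-`Q` per scale**: `legDressBarQ G P Q U n (legSliceCount … n k) ≤ 4·Q.CR·((Klam U)²·4^{-n} + (Klam|U|)³)` (at most four legs cross
a slice; `Q.CR ≥ 0`, `Klam ≥ 0`). -/
theorem klti_legDressBarQ_legSliceCount_le (G : GeoConsts) {P : SplitConsts} {Q : EngConsts} (hK : 0 ≤ P.Klam) (hQ : 0 ≤ Q.CR)
    (U μ : ℝ) (K : TrigPolyC4v) (n : ℕ) (k : Fin 4 → TorusSite 2 L) :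
    legDressBarQ G P Q U n (legSliceCount L μ K n k) ≤ 4 * (Q.CR * ((P.Klam * U) ^ 2 * ((4 : ℝ) ^ n)⁻¹ + (P.Klam * |U|) ^ 3)) := by
  unfold legDressBarQ
  have h4 : (legSliceCount L μ K n k : ℝ) ≤ 4 := by exact_mod_cast legSliceCount_le_four L μ K n k
  have h0 : 0 ≤ Q.CR * ((P.Klam * U) ^ 2 * ((4 : ℝ) ^ n)⁻¹ + (P.Klam * |U|) ^ 3) := by
    have : 0 ≤ (P.Klam * |U|) ^ 3 := pow_nonneg (mul_nonneg hK (abs_nonneg U)) 3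
    positivity
  nlinarith

omit [NeZero L] in
/-- **(D)-`Q` summed along the ladder** (any stretch `n ≤ N`, in particular the extended ladder `N = n_β + 1`):
`Σ_{n ≤ N} legDressBarQ G P Q U n (legSliceCount … n k) ≤ Q.CR·((16/3)·(Klam U)² + 20·(Klam|U|)³)`. -/
theorem klti_legDressBarQ_sum_le (G : GeoConsts) {P : SplitConsts} {Q : EngConsts} (hK : 0 ≤ P.Klam) (hQ : 0 ≤ Q.CR)
    (U μ : ℝ) (K : TrigPolyC4v) (k : Fin 4 → TorusSite 2 L) (N : ℕ) :
    ∑ n ∈ range (N + 1), legDressBarQ G P Q U n (legSliceCount L μ K n k) ≤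
      Q.CR * (16 / 3 * (P.Klam * U) ^ 2 + 20 * (P.Klam * |U|) ^ 3) := by
  -- split the majorant into its quadratic (profile `4^{-n}`, count `≤ 4`) and cubic (count summed `≤ 20`) parts
  have hsplit : ∀ n ∈ range (N + 1), legDressBarQ G P Q U n (legSliceCount L μ K n k) ≤
      Q.CR * (P.Klam * U) ^ 2 * (4 * ((4 : ℝ) ^ n)⁻¹) + Q.CR * (P.Klam * |U|) ^ 3 * (legSliceCount L μ K n k : ℝ) := by
    intro n _
    unfold legDressBarQ
    have h4 : (legSliceCount L μ K n k : ℝ) ≤ 4 := by exact_mod_cast legSliceCount_le_four L μ K n k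
    have h1 : 0 ≤ Q.CR * (P.Klam * U) ^ 2 * ((4 : ℝ) ^ n)⁻¹ := by positivity
    nlinarith
  refine (sum_le_sum hsplit).trans ?_
  rw [sum_add_distrib, ← mul_sum, ← mul_sum, ← mul_sum]
  have hgeo : ∑ n ∈ range (N + 1), ((4 : ℝ) ^ n)⁻¹ ≤ 4 / 3 := klti_sum_inv_four_pow_le N
  have hcnt : ∑ n ∈ range (N + 1), (legSliceCount L μ K n k : ℝ) ≤ 20 := by
    have h := legSliceCount_sum_le L μ K k N
    exact_mod_cast h
  have hA : 0 ≤ Q.CR * (P.Klam * U) ^ 2 := by positivity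
  have hB : 0 ≤ Q.CR * (P.Klam * |U|) ^ 3 := mul_nonneg hQ (pow_nonneg (mul_nonneg hK (abs_nonneg U)) 3)
  nlinarith

omit [NeZero L] in
/-- **(D)-`Q` summed between two scales**: `Σ_{n ∈ Ioc t N} legDressBarQ … ≤ Q.CR·((16/3)·(Klam U)² + 20·(Klam|U|)³)` (a sub-sum). -/
theorem klti_legDressBarQ_sum_Ioc_le (G : GeoConsts) {P : SplitConsts} {Q : EngConsts} (hK : 0 ≤ P.Klam) (hQ : 0 ≤ Q.CR)
    (U μ : ℝ) (K : TrigPolyC4v) (k : Fin 4 → TorusSite 2 L) (t N : ℕ) :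
    ∑ n ∈ Ioc t N, legDressBarQ G P Q U n (legSliceCount L μ K n k) ≤
      Q.CR * (16 / 3 * (P.Klam * U) ^ 2 + 20 * (P.Klam * |U|) ^ 3) := by
  refine le_trans ?_ (klti_legDressBarQ_sum_le L G hK hQ U μ K k N)
  refine sum_le_sum_of_subset_of_nonneg ?_ fun n _ _ => legDressBarQ_nonneg G hK hQ U n _
  intro n hn
  rw [mem_Ioc] at hn
  rw [mem_range]
  omega

omit [NeZero L] in
/-- **The whole V7 remainder budget of one value clause, summed over the extended ladder**: for `N ≤ n_β + 1`,
`Σ_{n ≤ N} (thermalBar G P U β n + legDressBarQ G P Q U n (legSliceCount … n k)) ≤ (7/3)·CF·(Klam U)² + Q.CR·((16/3)(Klam U)² + 20(Klam|U|)³)`. -/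
theorem klti_thermal_add_legQ_sum_le {G : GeoConsts} (hG : 0 ≤ G.CF) {P : SplitConsts} {Q : EngConsts} (hK : 0 ≤ P.Klam)
    (hQ : 0 ≤ Q.CR) (U β μ : ℝ) (K : TrigPolyC4v) (k : Fin 4 → TorusSite 2 L) {N : ℕ} (hN : N ≤ nScales β + 1) :
    ∑ n ∈ range (N + 1), (thermalBar G P U β n + legDressBarQ G P Q U n (legSliceCount L μ K n k)) ≤
      7 / 3 * (G.CF * (P.Klam * U) ^ 2) + Q.CR * (16 / 3 * (P.Klam * U) ^ 2 + 20 * (P.Klam * |U|) ^ 3) := by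
  rw [sum_add_distrib]
  exact add_le_add (klth_thermalBar_sum_le_succ hG P U β hN) (klti_legDressBarQ_sum_le L G hK hQ U μ K k N)

end LegQ

end Summit.HubbardSuperconductivity.HubbardSuperconductivity.Theorems.KLRegimeSplit

end
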